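import Literature.RepresentationTheory.FiniteGroups.SymmetricGroupFixedWords
import Literature.NumberTheory.DiophantineGeometry.SchurWeylHighestWeightProofs
import HarnessLib

/-!
# Orthogonality of Frobenius's alternating coefficients: `∑_σ X^λ(σ)² = D!`

Topic `Literature/RepresentationTheory/FiniteGroups`; second step of the proof of Frobenius's
character formula for the symmetric groups (Fulton–Harris, *Representation Theory*, §4.3,
Prop. 4.37 through formulas (4.13)–(4.16); Macdonald, *Symmetric Functions*, Ch. I §7 (7.3)–(7.6)).
With `F_σ(x) = ∑_{w ∘ σ = w} x^{cont w}` the fixed-word enumerator (`= ∏ p_{cycle lengths}`) and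
`X^{lam}(σ) = [x^{lam+ρ}](a_ρ(x) F_σ(x))` Frobenius's alternating coefficient
(`SymmetricGroupFixedWords.lean`), this file PROVES, for every finite position set `ι` and every
exponent vector `lam ∈ ℕ^N` with `|lam| = |ι|` and `lam + ρ` injective:

* `sum_frobeniusChar_mul_self` — **`∑_{σ ∈ 𝔖_ι} X^{lam}(σ)² = |ι|!`** (Fulton–Harris (4.16),
  `⟨ω_λ, ω_λ⟩ = 1`), through the bilinear form
  `sum_coeff_mul_coeff_alternant_mul_fixedWordPoly`:
  `∑_σ [x^α](a_ρF_σ) · [x^β](a_ρF_σ) = |ι|! · [x^α] a_β(x)` whenever `|β| = |ι| + |ρ|`.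

The proof is Frobenius's, organised so that only finite sums of monomials occur:

1. **Burnside / cycle index** (`sum_perm_sum_fixed_prod_eq`, `sum_fixedWordEnum_mul`):
   `∑_σ F_σ(x) F_σ(y) = ∑_{u : ι → [N]²} |Stab u| (x⊗y)^{cont u} = |ι|! · h_{|ι|}(x ⊗ y)`, since a
   pair of fixed words is a fixed word in the alphabet `[N]²`, and over the words of one content
   (one `𝔖_ι`-orbit, `exists_perm_comp_eq_of_card_fiber_eq` of the tree) the stabiliser orders sum
   to `|ι|!` (`sum_card_stab_eq_factorial`; every content occurs, `exists_word_of_content`). This is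
   `∑_𝐢 P^{(𝐢)}(x)P^{(𝐢)}(y)/z(𝐢) = ∏_{i,j}(1 - x_i y_j)⁻¹` (Fulton–Harris (4.15), (A.32)) degree by
   degree.
2. **Cauchy** (`sum_piAntidiag_alternant_mul_prod_pow`): `a_ρ(x)a_ρ(y) h_D(x⊗y) =
   ∑_{|m| = D+|ρ|} a_m(x) y^m`, the `T^{D+|ρ|}`-coefficient of the tree's Cauchy determinant
   `altSeries_mul_cauchyProd` (`SchurPolynomials.lean`; Macdonald I (4.3)).
3. **Extraction** in the iterated polynomial ring `ℤ[y][x]` (`coeff_coeff_map_mul_C`): comparing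
   the coefficients of `x^α y^β` gives the bilinear form, and `[x^{lam+ρ}] a_{lam+ρ}(x) = 1` for
   injective `lam + ρ` (`coeff_alternant_X_self`).

No representation theory enters this file; the identification `X^λ = χ^λ` is
`SymmetricGroupFrobeniusFormula.lean`.

## References

* W. Fulton, J. Harris, *Representation Theory. A First Course*, GTM 129 (1991), §4.3
  (Prop. 4.37, (4.13)–(4.16)) and Appendix A (A.32). [FultonHarrisGTM129]
* I. G. Macdonald, *Symmetric Functions and Hall Polynomials*, 2nd ed. (1995), Ch. I §2 (2.14'),
  §4 (4.3), §7. [Macdonald1995]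

## Mathlib and tree

Mathlib: `PowerSeries.coeff_prod`, `Finset.piAntidiag`/`finsuppAntidiag`,
`Finset.sum_fiberwise_of_maps_to`, `Finset.card_equiv`, `Fintype.equivOfCardEq`,
`Equiv.arrowProdEquivProdArrow`, `MvPolynomial.map`/`coeff_map`/`coeff_C_mul`/`coeff_monomial`.
Tree: `alternant`, `rho`, `geom`, `altSeries`, `cauchyProd`, `altSeries_mul_cauchyProd`,
`map_alternant` (`SchurPolynomials.lean`); `fixedWordPoly`, `frobeniusChar`,
`alternant_X_eq_sum_monomial` (`SymmetricGroupFixedWords.lean`);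
`exists_perm_comp_eq_of_card_fiber_eq` (`SchurWeylHighestWeightProofs.lean`).
-/

noncomputable section

open scoped BigOperators
open MvPolynomial Finset

namespace Literature.RepresentationTheory.FiniteGroups

open Literature.RingTheory.SymmetricFunctions.SymmPoly (alternant alternant_eq_sum rho geom coeff_geom
  geom_mul_one_sub altSeries cauchyProd altSeries_mul_cauchyProd map_alternant)
open Literature.NumberTheory.DiophantineGeometry (exists_perm_comp_eq_of_card_fiber_eq)

/-! ### Orbit–stabilizer bookkeeping for words -/

section Orbit

variable {ι α : Type*} [Fintype ι] [DecidableEq ι] [Fintype α] [DecidableEq α]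

/-- Exchange of summations: `∑_σ ∑_{u ∘ σ = u} f u = ∑_u |Stab u| • f u`. [folklore] -/
theorem sum_perm_sum_fixed_eq {M : Type*} [AddCommMonoid M] (f : (ι → α) → M) :
    ∑ σ : Equiv.Perm ι, ∑ u ∈ univ.filter (fun u : ι → α => u ∘ ⇑σ = u), f u =
      ∑ u : ι → α, (univ.filter fun σ : Equiv.Perm ι => u ∘ ⇑σ = u).card • f u := by
  simp_rw [Finset.sum_filter]
  rw [Finset.sum_comm]
  refine Finset.sum_congr rfl fun u _ => ?_
  rw [← Finset.sum_filter, Finset.sum_const]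

omit [Fintype α] in
/-- The stabiliser of a translate `u ∘ g` is conjugate to that of `u`; same cardinality.
[folklore] -/
theorem card_stab_comp_perm (u : ι → α) (g : Equiv.Perm ι) :
    (univ.filter fun σ : Equiv.Perm ι => (u ∘ ⇑g) ∘ ⇑σ = u ∘ ⇑g).card =
      (univ.filter fun σ : Equiv.Perm ι => u ∘ ⇑σ = u).card := by
  refine Finset.card_equiv (MulAut.conj g).toEquiv fun σ => ?_
  simp only [mem_filter, mem_univ, true_and, MulEquiv.toEquiv_eq_coe, MulEquiv.coe_toEquiv,
    MulAut.conj_apply]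
  constructor
  · intro h
    funext p
    have := congr_fun h (g⁻¹ p)
    simpa using this
  · intro h
    funext p
    have := congr_fun h (g p)
    simpa using this

/-- The translates `u₀ ∘ g`, `g ∈ 𝔖_ι`, hit every word of the same content exactly `|Stab u₀|`
times: `∑_g f(u₀ ∘ g) = |Stab u₀| • ∑_{cont u = cont u₀} f u`. [folklore] -/
theorem sum_comp_perm_eq_card_stab_smul {M : Type*} [AddCommMonoid M] (u₀ : ι → α)
    (f : (ι → α) → M) :
    ∑ g : Equiv.Perm ι, f (u₀ ∘ ⇑g) =
      (univ.filter fun σ : Equiv.Perm ι => u₀ ∘ ⇑σ = u₀).card •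
        ∑ u ∈ univ.filter (fun u : ι → α =>
          ∀ a, (univ.filter fun p => u p = a).card = (univ.filter fun p => u₀ p = a).card), f u := by
  set T := univ.filter (fun u : ι → α =>
    ∀ a, (univ.filter fun p => u p = a).card = (univ.filter fun p => u₀ p = a).card) with hT
  have hmaps : ∀ g ∈ (univ : Finset (Equiv.Perm ι)), u₀ ∘ ⇑g ∈ T := by
    intro g _
    simp only [hT, mem_filter, mem_univ, true_and, Function.comp_apply]
    intro a
    exact Finset.card_equiv g fun p => by simp
  rw [← Finset.sum_fiberwise_of_maps_to hmaps, Finset.smul_sum]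
  refine Finset.sum_congr rfl fun u hu => ?_
  have hu' : ∀ a, (univ.filter fun p => u₀ p = a).card = (univ.filter fun p => u p = a).card := by
    simp only [hT, mem_filter, mem_univ, true_and] at hu
    exact fun a => (hu a).symm
  obtain ⟨g₀, hg₀⟩ := exists_perm_comp_eq_of_card_fiber_eq u₀ u hu'
  have hg₀' : u₀ ∘ ⇑g₀ = u := funext hg₀
  have hfib : ∀ g ∈ univ.filter (fun g : Equiv.Perm ι => u₀ ∘ ⇑g = u), f (u₀ ∘ ⇑g) = f u := by
    intro g hg
    rw [(mem_filter.1 hg).2]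
  rw [Finset.sum_congr rfl hfib, Finset.sum_const]
  congr 1
  refine Finset.card_equiv (Equiv.mulRight g₀⁻¹) fun g => ?_
  simp only [mem_filter, mem_univ, true_and, Equiv.coe_mulRight]
  rw [← hg₀']
  constructor
  · intro h
    funext p
    have := congr_fun h (g₀⁻¹ p)
    simp only [Function.comp_apply, Equiv.Perm.coe_mul] at this ⊢
    rw [this]
    simp
  · intro h
    funext p
    have := congr_fun h (g₀ p)
    simp only [Function.comp_apply, Equiv.Perm.coe_mul] at this
    simpa using this

/-- **Orbit–stabilizer**: over the words of a given content (one `𝔖_ι`-orbit) the stabiliser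
orders add up to `|ι|!`. [folklore] -/
theorem sum_card_stab_eq_factorial (u₀ : ι → α) :
    ∑ u ∈ univ.filter (fun u : ι → α =>
        ∀ a, (univ.filter fun p => u p = a).card = (univ.filter fun p => u₀ p = a).card),
      (univ.filter fun σ : Equiv.Perm ι => u ∘ ⇑σ = u).card = (Fintype.card ι).factorial := by
  have h := sum_comp_perm_eq_card_stab_smul u₀
    (fun u => (univ.filter fun σ : Equiv.Perm ι => u ∘ ⇑σ = u).card)
  simp only [card_stab_comp_perm, Finset.sum_const, Finset.card_univ, Fintype.card_perm,
    smul_eq_mul] at h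
  have hpos : 0 < (univ.filter fun σ : Equiv.Perm ι => u₀ ∘ ⇑σ = u₀).card :=
    Finset.card_pos.2 ⟨1, by simp⟩
  exact (Nat.eq_of_mul_eq_mul_left hpos ((mul_comm _ _).trans h)).symm

omit [DecidableEq ι] in
/-- Every content vector `M : α → ℕ` with `∑ M = |ι|` is the content of some word `ι → α`.
[folklore] -/
theorem exists_word_of_content (M : α → ℕ) (hM : ∑ a, M a = Fintype.card ι) :
    ∃ u : ι → α, ∀ a, (univ.filter fun p => u p = a).card = M a := by
  have hcard : Fintype.card ι = Fintype.card (Σ a : α, Fin (M a)) := by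
    rw [Fintype.card_sigma]
    simp [hM]
  let e : ι ≃ (Σ a : α, Fin (M a)) := Fintype.equivOfCardEq hcard
  refine ⟨fun p => (e p).1, fun a => ?_⟩
  have h1 : (univ.filter fun p : ι => (e p).1 = a).card =
      (univ.filter fun s : (Σ a : α, Fin (M a)) => s.1 = a).card :=
    Finset.card_equiv e fun p => by simp
  rw [h1]
  have h2 : (univ.filter fun s : (Σ a : α, Fin (M a)) => s.1 = a) =
      (univ : Finset (Fin (M a))).map (Function.Embedding.sigmaMk a) := by
    ext ⟨b, k⟩
    simp only [mem_filter, mem_univ, true_and, mem_map, Function.Embedding.sigmaMk_apply]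
    constructor
    · rintro rfl
      exact ⟨k, rfl⟩
    · rintro ⟨k', hk'⟩
      exact (Sigma.mk.inj_iff.1 hk').1.symm
  rw [h2, card_map, card_univ, Fintype.card_fin]

/-- For every content `M` with `∑ M = |ι|`: `∑_{cont u = M} |Stab u| = |ι|!`. [folklore] -/
theorem sum_card_stab_eq_factorial_of_content (M : α → ℕ) (hM : ∑ a, M a = Fintype.card ι) :
    ∑ u ∈ univ.filter (fun u : ι → α => ∀ a, (univ.filter fun p => u p = a).card = M a),
      (univ.filter fun σ : Equiv.Perm ι => u ∘ ⇑σ = u).card = (Fintype.card ι).factorial := by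
  obtain ⟨u₀, hu₀⟩ := exists_word_of_content M hM
  rw [← sum_card_stab_eq_factorial u₀]
  refine Finset.sum_congr ?_ fun _ _ => rfl
  ext u
  simp only [mem_filter, mem_univ, true_and, hu₀]

omit [DecidableEq ι] in
/-- The content of a word sums to the number of positions. [folklore] -/
theorem sum_card_filter_eq_card (u : ι → α) :
    ∑ a, (univ.filter fun p => u p = a).card = Fintype.card ι := by
  rw [← Finset.card_univ, Finset.card_eq_sum_card_fiberwise (f := u) (t := univ)
    (fun _ _ => mem_univ _)]

end Orbit

/-! ### Burnside: `∑_σ F_σ(x) F_σ(y) = D! · h_D(x ⊗ y)` -/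

section Burnside

variable {ι : Type*} [Fintype ι] [DecidableEq ι] {N : ℕ} {R : Type*} [CommRing R]

/-- The fixed-word enumerator evaluated at a point `x ∈ R^N`: `F_σ(x) = ∑_{w∘σ=w} ∏_p x_{w p}`.
[folklore] -/
theorem eval₂Hom_fixedWordPoly (f : ℤ →+* R) (x : Fin N → R) (σ : Equiv.Perm ι) :
    eval₂Hom f x (fixedWordPoly N σ) =
      ∑ w ∈ univ.filter (fun w : ι → Fin N => w ∘ ⇑σ = w), ∏ p, x (w p) := by
  unfold fixedWordPoly
  rw [map_sum]
  refine Finset.sum_congr rfl fun w _ => ?_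
  rw [map_prod]
  simp

omit [DecidableEq ι] in
/-- A product over the positions of a word, grouped by letter: `∏_p z_{u p} = ∏_a z_a^{cont(u)_a}`.
[folklore] -/
theorem prod_apply_eq_prod_pow_card {α : Type*} [Fintype α] [DecidableEq α] (z : α → R) (u : ι → α) :
    ∏ p, z (u p) = ∏ a, z a ^ (univ.filter fun p => u p = a).card := by
  rw [← Finset.prod_fiberwise' univ u z]
  exact Finset.prod_congr rfl fun a _ => Finset.prod_const _

/-- **The cycle-index identity** `∑_{σ ∈ 𝔖_ι} ∑_{u ∘ σ = u} z^{u} = |ι|! · h_{|ι|}(z)`, i.e.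
`∑_σ p_{ρ(σ)}(z) = |ι|! · ∑_{|M| = |ι|} z^M` (Pólya; Macdonald I (2.14'), `h_n = ∑_{|ρ|=n} z_ρ⁻¹ p_ρ`):
exchanging the sums gives `∑_u |Stab u| z^{cont u}`, and over the words of a fixed content
(one orbit) the stabiliser orders add up to `|ι|!`. [cite: Macdonald1995, Ch. I §2 (2.14')] -/
theorem sum_perm_sum_fixed_prod_eq {α : Type*} [Fintype α] [DecidableEq α] (z : α → R) :
    ∑ σ : Equiv.Perm ι, ∑ u ∈ univ.filter (fun u : ι → α => u ∘ ⇑σ = u), ∏ p, z (u p) =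
      (Fintype.card ι).factorial •
        ∑ M ∈ piAntidiag (univ : Finset α) (Fintype.card ι), ∏ a, z a ^ M a := by
  rw [sum_perm_sum_fixed_eq]
  simp_rw [prod_apply_eq_prod_pow_card z]
  have hmaps : ∀ u ∈ (univ : Finset (ι → α)),
      (fun a => (univ.filter fun p => u p = a).card) ∈ piAntidiag (univ : Finset α) (Fintype.card ι) := by
    intro u _
    rw [mem_piAntidiag]
    exact ⟨sum_card_filter_eq_card u, fun a _ => mem_univ a⟩
  rw [← Finset.sum_fiberwise_of_maps_to hmaps, Finset.smul_sum]
  refine Finset.sum_congr rfl fun M hM => ?_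
  rw [mem_piAntidiag] at hM
  have hfib : ∀ u ∈ univ.filter (fun u : ι → α => (fun a => (univ.filter fun p => u p = a).card) = M),
      (univ.filter fun σ : Equiv.Perm ι => u ∘ ⇑σ = u).card • ∏ a, z a ^ (univ.filter fun p => u p = a).card =
      (univ.filter fun σ : Equiv.Perm ι => u ∘ ⇑σ = u).card • ∏ a, z a ^ M a := by
    intro u hu
    have hu2 := congr_fun (mem_filter.1 hu).2
    exact congr_arg _ (Finset.prod_congr rfl fun a _ => by rw [← hu2 a])
  rw [Finset.sum_congr rfl hfib, ← Finset.sum_smul]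
  congr 1
  rw [← sum_card_stab_eq_factorial_of_content (ι := ι) M hM.1]
  refine Finset.sum_congr ?_ fun _ _ => rfl
  ext u
  simp only [mem_filter, mem_univ, true_and]
  exact funext_iff

/-- A pair of words is a word in the product alphabet: `(∑_{w∘σ=w} x^w)(∑_{w∘σ=w} y^w) =
∑_{u ∘ σ = u} ∏_p x_{(u p).1} y_{(u p).2}` over `u : ι → [N] × [N]`. [folklore] -/
theorem sum_fixed_mul_sum_fixed (x y : Fin N → R) (σ : Equiv.Perm ι) :
    (∑ w ∈ univ.filter (fun w : ι → Fin N => w ∘ ⇑σ = w), ∏ p, x (w p)) *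
      (∑ w ∈ univ.filter (fun w : ι → Fin N => w ∘ ⇑σ = w), ∏ p, y (w p)) =
    ∑ u ∈ univ.filter (fun u : ι → Fin N × Fin N => u ∘ ⇑σ = u),
      ∏ p, (x (u p).1 * y (u p).2) := by
  rw [Finset.sum_mul_sum, ← Finset.sum_product']
  refine Finset.sum_equiv (Equiv.arrowProdEquivProdArrow ι (fun _ => Fin N) (fun _ => Fin N)).symm ?_ ?_
  · rintro ⟨w₁, w₂⟩
    simp only [Finset.mem_product, mem_filter, mem_univ, true_and]
    constructor
    · rintro ⟨h₁, h₂⟩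
      funext p
      change (w₁ (σ p), w₂ (σ p)) = (w₁ p, w₂ p)
      exact Prod.ext (congr_fun h₁ p) (congr_fun h₂ p)
    · intro h
      refine ⟨funext fun p => ?_, funext fun p => ?_⟩
      · exact congr_arg Prod.fst (congr_fun h p)
      · exact congr_arg Prod.snd (congr_fun h p)
  · rintro ⟨w₁, w₂⟩ -
    rw [← Finset.prod_mul_distrib]
    rfl

/-- **Burnside's count for pairs of fixed words**: for `x, y ∈ R^N`,
`∑_{σ ∈ 𝔖_ι} F_σ(x) F_σ(y) = |ι|! · ∑_{M : [N]² → ℕ, |M| = |ι|} ∏_{(i,j)} (x_i y_j)^{M(i,j)}`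
(`= |ι|! · h_{|ι|}(x ⊗ y)`, Fulton–Harris §4.3 (4.15)/(A.32): `∑_𝐢 P^{(𝐢)}(x)P^{(𝐢)}(y)/z(𝐢) =
∏_{i,j}(1-x_iy_j)⁻¹` in degree `|ι|`): the cycle-index identity in the alphabet `[N]²`.
[cite: FultonHarrisGTM129, §4.3 (4.15)] -/
theorem sum_fixedWordEnum_mul (x y : Fin N → R) :
    ∑ σ : Equiv.Perm ι,
      (∑ w ∈ univ.filter (fun w : ι → Fin N => w ∘ ⇑σ = w), ∏ p, x (w p)) *
      (∑ w ∈ univ.filter (fun w : ι → Fin N => w ∘ ⇑σ = w), ∏ p, y (w p)) =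
    (Fintype.card ι).factorial •
      ∑ M ∈ piAntidiag (univ : Finset (Fin N × Fin N)) (Fintype.card ι),
        ∏ c : Fin N × Fin N, (x c.1 * y c.2) ^ M c := by
  simp_rw [sum_fixed_mul_sum_fixed]
  exact sum_perm_sum_fixed_prod_eq (fun c : Fin N × Fin N => x c.1 * y c.2)

end Burnside


/-! ### Cauchy: `a_ρ(x) a_ρ(y) h_D(x ⊗ y) = ∑_{|m| = D + |ρ|} a_m(x) y^m` -/

section Cauchy

variable {R : Type*} [CommRing R] {N : ℕ}

/-- Reindex a sum over `finsuppAntidiag univ D` by `piAntidiag univ D` (general finite index type;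
the tree's `sum_finsuppAntidiag_eq_sum_piAntidiag` is the case `Fin n`). [folklore] -/
theorem sum_finsuppAntidiag_eq_sum_piAntidiag' {κ A : Type*} [Fintype κ] [DecidableEq κ]
    [AddCommMonoid A] (D : ℕ) (F : (κ → ℕ) → A) :
    ∑ l ∈ finsuppAntidiag (univ : Finset κ) D, F l = ∑ m ∈ piAntidiag univ D, F m := by
  refine Finset.sum_nbij' (fun l => ⇑l) (fun m => Finsupp.equivFunOnFinite.symm m) ?_ ?_ ?_ ?_ ?_
  · intro l hl
    rw [mem_finsuppAntidiag] at hl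
    rw [mem_piAntidiag]
    exact ⟨hl.1, fun i _ => mem_univ i⟩
  · intro m hm
    rw [mem_piAntidiag] at hm
    rw [mem_finsuppAntidiag]
    refine ⟨?_, Finset.subset_univ _⟩
    simpa using hm.1
  · intro l _
    ext i
    simp
  · intro m _
    simp
  · intro l _
    rfl

/-- `[T^D] ∏_k (1 - c_k T)⁻¹ = ∑_{|M| = D} c^M` for any finite index set (the tree's
`coeff_prod_geom` is the case `Fin n`). [folklore] -/
theorem coeff_prod_geom' {κ : Type*} [Fintype κ] [DecidableEq κ] (c : κ → R) (D : ℕ) :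
    PowerSeries.coeff D (∏ k, geom (c k)) = ∑ M ∈ piAntidiag (univ : Finset κ) D, ∏ k, c k ^ M k := by
  rw [PowerSeries.coeff_prod]
  simp only [coeff_geom]
  exact sum_finsuppAntidiag_eq_sum_piAntidiag' D (fun M => ∏ k, c k ^ M k)

/-- `∏_{i,j} (1 - x_i y_j T) · ∏_{i,j} (1 - x_i y_j T)⁻¹ = 1`. [folklore] -/
theorem cauchyProd_mul_prod_geom (x y : Fin N → R) :
    cauchyProd x y * ∏ c : Fin N × Fin N, geom (x c.1 * y c.2) = 1 := by
  unfold cauchyProd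
  rw [← Fintype.prod_prod_type' (fun i j => (1 - PowerSeries.C (x i * y j) * PowerSeries.X)),
    ← Finset.prod_mul_distrib]
  refine Finset.prod_eq_one fun c _ => ?_
  rw [mul_comm, geom_mul_one_sub]

/-- **Cauchy's identity for bialternants, degree by degree**: for `x, y ∈ R^N` and every `D`,
`∑_{m ∈ ℕ^N, |m| = D + |ρ|} a_m(x) y^m = a_ρ(x) a_ρ(y) · ∑_{M : [N]² → ℕ, |M| = D} ∏_{i,j} (x_i y_j)^{M(i,j)}`
(`= a_ρ(x) a_ρ(y) h_D(x ⊗ y)`), the `T^{D+|ρ|}`-coefficient of the tree's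
`altSeries_mul_cauchyProd` (`A_{x,y}(T) ∏(1 - x_i y_j T) = T^{|ρ|} a_ρ(x) a_ρ(y)`; Macdonald I (4.3),
Fulton–Harris (A.13)/(4.15)). [cite: Macdonald1995, Ch. I §4 (4.3)] -/
theorem sum_piAntidiag_alternant_mul_prod_pow (x y : Fin N → R) (D : ℕ) :
    ∑ m ∈ piAntidiag univ (D + ∑ i, rho N i), alternant x m * ∏ i, y i ^ m i =
      alternant x (rho N) * alternant y (rho N) *
        ∑ M ∈ piAntidiag (univ : Finset (Fin N × Fin N)) D, ∏ c, (x c.1 * y c.2) ^ M c := by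
  have hG : altSeries x y = PowerSeries.X ^ (∑ i, rho N i) *
      PowerSeries.C (alternant x (rho N) * alternant y (rho N)) *
        ∏ c : Fin N × Fin N, geom (x c.1 * y c.2) := by
    calc altSeries x y
        = altSeries x y * (cauchyProd x y * ∏ c : Fin N × Fin N, geom (x c.1 * y c.2)) := by
          rw [cauchyProd_mul_prod_geom, mul_one]
      _ = _ := by rw [← mul_assoc, altSeries_mul_cauchyProd]
  have h := congr_arg (PowerSeries.coeff (D + ∑ i, rho N i)) hG
  rw [altSeries, PowerSeries.coeff_mk] at h
  rw [h, mul_assoc, PowerSeries.coeff_X_pow_mul', if_pos (Nat.le_add_left _ _), Nat.add_sub_cancel,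
    PowerSeries.coeff_C_mul, coeff_prod_geom', mul_assoc]

end Cauchy

/-! ### Extraction of coefficients: `∑_σ X^α(σ) X^β(σ) = D! · [x^α] a_β(x)` -/

section Extraction

variable {ι : Type*} [Fintype ι] [DecidableEq ι] {N : ℕ}

/-- `∏_i X_i^{m_i}` is the monomial `X^m`. [folklore] -/
theorem prod_X_pow_eq_monomial' {R : Type*} [CommSemiring R] (m : Fin N → ℕ) :
    ∏ i, (X i : MvPolynomial (Fin N) R) ^ m i = monomial (Finsupp.equivFunOnFinite.symm m) 1 := by
  rw [monomial_eq, C_1, one_mul, Finsupp.prod_fintype _ _ (fun i => pow_zero _)]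
  simp

/-- The coefficients of the alternant at the generic point: `[x^α] a_μ(X) = ∑_τ sign(τ) [μ∘τ⁻¹ = α]`.
[folklore] -/
theorem coeff_alternant_X (μ : Fin N → ℕ) (α : Fin N →₀ ℕ) :
    coeff α (alternant (fun i => (X i : MvPolynomial (Fin N) ℤ)) μ) =
      ∑ τ : Equiv.Perm (Fin N), if (Finsupp.equivFunOnFinite.symm fun j => μ (τ⁻¹ j)) = α then
        (Equiv.Perm.sign τ : ℤ) else 0 := by
  rw [alternant_X_eq_sum_monomial, coeff_sum]
  refine Finset.sum_congr rfl fun τ _ => ?_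
  have hC : ((Equiv.Perm.sign τ : ℤ) : MvPolynomial (Fin N) ℤ) = C (Equiv.Perm.sign τ : ℤ) := by
    simp
  rw [hC, coeff_C_mul, coeff_monomial]
  split_ifs <;> simp

/-- For an exponent vector `μ` with distinct entries, `x^μ` occurs in `a_μ(X)` with coefficient `1`
(only `τ = 1` has `μ ∘ τ⁻¹ = μ`). [folklore] -/
theorem coeff_alternant_X_self {μ : Fin N → ℕ} (hμ : Function.Injective μ) :
    coeff (Finsupp.equivFunOnFinite.symm μ) (alternant (fun i => (X i : MvPolynomial (Fin N) ℤ)) μ) = 1 := by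
  rw [coeff_alternant_X, Finset.sum_eq_single (1 : Equiv.Perm (Fin N))]
  · simp
  · intro τ _ hτ
    rw [if_neg]
    intro h
    apply hτ
    ext j
    have hj := congr_arg (fun f : Fin N →₀ ℕ => f (τ j)) h
    simp at hj
    rw [Equiv.Perm.one_apply]
    exact congr_arg Fin.val (hμ hj).symm
  · intro h
    exact absurd (mem_univ _) h

/-- The two embeddings `P ↦ P(x)` (outer variables) and `P ↦ P(y)` (constants) of `ℤ[x]` into the
iterated polynomial ring `ℤ[y][x]`, and extraction of the coefficient of `x^α y^β` from a product
`P(x) Q(y)`. [folklore] -/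
theorem coeff_coeff_map_mul_C (P Q : MvPolynomial (Fin N) ℤ) (α β : Fin N →₀ ℕ) :
    coeff β (coeff α (MvPolynomial.map (C : ℤ →+* MvPolynomial (Fin N) ℤ) P * C Q)) =
      coeff α P * coeff β Q := by
  rw [mul_comm, coeff_C_mul, coeff_map, mul_comm, coeff_C_mul]

/-- **Orthogonality of Frobenius's coefficients, bilinear form**: for exponent vectors `α, β` with
`|β| = |ι| + |ρ|`,
`∑_{σ ∈ 𝔖_ι} [x^α](a_ρ F_σ) · [x^β](a_ρ F_σ) = |ι|! · [x^α] a_β(x)`.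
Proof: in `ℤ[y][x]`, `∑_σ a_ρ(x)F_σ(x) · a_ρ(y)F_σ(y) = a_ρ(x)a_ρ(y) · |ι|! h_{|ι|}(x ⊗ y)`
(Burnside, `sum_fixedWordEnum_mul`) `= |ι|! ∑_{|m| = |ι|+|ρ|} a_m(x) y^m` (Cauchy,
`sum_piAntidiag_alternant_mul_prod_pow`); compare coefficients of `x^α y^β`. This is
Fulton–Harris (4.15)–(4.16) (`∑_𝐢 ω_λ(𝐢)ω_μ(𝐢)/z(𝐢) = δ_{λμ}`). [cite: FultonHarrisGTM129, §4.3 (4.16)] -/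
theorem sum_coeff_mul_coeff_alternant_mul_fixedWordPoly (α β : Fin N →₀ ℕ)
    (hβ : ∑ i, β i = Fintype.card ι + ∑ i, rho N i) :
    ∑ σ : Equiv.Perm ι,
      coeff α (alternant (fun i => (X i : MvPolynomial (Fin N) ℤ)) (rho N) * fixedWordPoly N σ) *
      coeff β (alternant (fun i => (X i : MvPolynomial (Fin N) ℤ)) (rho N) * fixedWordPoly N σ) =
    (Fintype.card ι).factorial * coeff α (alternant (fun i => (X i : MvPolynomial (Fin N) ℤ)) β) := by
  -- the two points `x` (outer variables) and `y` (constants) of the iterated ring `ℤ[y][x]`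
  set x : Fin N → MvPolynomial (Fin N) (MvPolynomial (Fin N) ℤ) := fun i => X i with hx
  set y : Fin N → MvPolynomial (Fin N) (MvPolynomial (Fin N) ℤ) := fun j => C (X j) with hy
  set aρ : MvPolynomial (Fin N) ℤ := alternant (fun i => (X i : MvPolynomial (Fin N) ℤ)) (rho N)
    with haρ
  -- images of the alternant and of `F_σ` under the two embeddings
  have hax : MvPolynomial.map (C : ℤ →+* MvPolynomial (Fin N) ℤ) aρ = alternant x (rho N) := by
    rw [haρ, map_alternant]
    congr 1
    funext i
    exact map_X _ _
  have hay : C aρ = alternant y (rho N) := by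
    rw [haρ, map_alternant]
    rfl
  have hFx : ∀ σ : Equiv.Perm ι,
      MvPolynomial.map (C : ℤ →+* MvPolynomial (Fin N) ℤ) (fixedWordPoly N σ) =
      ∑ w ∈ univ.filter (fun w : ι → Fin N => w ∘ ⇑σ = w), ∏ p, x (w p) := by
    intro σ
    unfold fixedWordPoly
    rw [map_sum]
    refine Finset.sum_congr rfl fun w _ => ?_
    rw [map_prod]
    exact Finset.prod_congr rfl fun p _ => map_X _ _
  have hFy : ∀ σ : Equiv.Perm ι, C (fixedWordPoly N σ) =
      ∑ w ∈ univ.filter (fun w : ι → Fin N => w ∘ ⇑σ = w), ∏ p, y (w p) := by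
    intro σ
    unfold fixedWordPoly
    rw [map_sum]
    refine Finset.sum_congr rfl fun w _ => ?_
    rw [map_prod]
  -- the key identity in `ℤ[y][x]`
  have key : ∑ σ : Equiv.Perm ι,
      MvPolynomial.map (C : ℤ →+* MvPolynomial (Fin N) ℤ) (aρ * fixedWordPoly N σ) *
        C (aρ * fixedWordPoly N σ) =
      ((Fintype.card ι).factorial : MvPolynomial (Fin N) (MvPolynomial (Fin N) ℤ)) *
        ∑ m ∈ piAntidiag univ (Fintype.card ι + ∑ i, rho N i), alternant x m * ∏ i, y i ^ m i := by
    have h1 : ∀ σ : Equiv.Perm ι,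
        MvPolynomial.map (C : ℤ →+* MvPolynomial (Fin N) ℤ) (aρ * fixedWordPoly N σ) *
          C (aρ * fixedWordPoly N σ) =
        alternant x (rho N) * alternant y (rho N) *
          ((∑ w ∈ univ.filter (fun w : ι → Fin N => w ∘ ⇑σ = w), ∏ p, x (w p)) *
           (∑ w ∈ univ.filter (fun w : ι → Fin N => w ∘ ⇑σ = w), ∏ p, y (w p))) := by
      intro σ
      rw [map_mul, map_mul, hax, hay, hFx, hFy]
      ring
    simp_rw [h1]
    rw [← Finset.mul_sum, sum_fixedWordEnum_mul, sum_piAntidiag_alternant_mul_prod_pow, nsmul_eq_mul]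
    ring
  -- extract the coefficient of `x^α y^β`
  have hE := congr_arg (fun Q : MvPolynomial (Fin N) (MvPolynomial (Fin N) ℤ) => coeff β (coeff α Q)) key
  simp only [coeff_sum, coeff_coeff_map_mul_C] at hE
  rw [hE]
  -- right-hand side
  have hnat : ((Fintype.card ι).factorial : MvPolynomial (Fin N) (MvPolynomial (Fin N) ℤ)) =
      C (C ((Fintype.card ι).factorial : ℤ)) := by simp
  have hterm : ∀ m : Fin N → ℕ, coeff β (coeff α (alternant x m * ∏ i, y i ^ m i)) =
      if m = ⇑β then coeff α (alternant (fun i => (X i : MvPolynomial (Fin N) ℤ)) m) else 0 := by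
    intro m
    have hm1 : alternant x m = MvPolynomial.map (C : ℤ →+* MvPolynomial (Fin N) ℤ)
        (alternant (fun i => (X i : MvPolynomial (Fin N) ℤ)) m) := by
      rw [map_alternant]
      congr 1
      funext i
      exact (map_X _ _).symm
    have hm2 : ∏ i, y i ^ m i = C (∏ i, (X i : MvPolynomial (Fin N) ℤ) ^ m i) := by
      rw [map_prod]
      exact Finset.prod_congr rfl fun i _ => by rw [map_pow]
    rw [hm1, hm2, coeff_coeff_map_mul_C, prod_X_pow_eq_monomial', coeff_monomial]
    by_cases hm : m = ⇑β
    · subst hm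
      simp
    · rw [if_neg hm, if_neg, mul_zero]
      intro h
      apply hm
      rw [← h]
      simp
  rw [hnat, coeff_C_mul, coeff_sum, coeff_C_mul, coeff_sum]
  simp_rw [hterm]
  rw [Finset.sum_ite_eq']
  rw [if_pos]
  rw [mem_piAntidiag]
  exact ⟨hβ, fun i _ => mem_univ i⟩

/-- **Orthogonality of Frobenius's coefficients** (`⟨ω_λ, ω_λ⟩ = 1`, Fulton–Harris (4.16)): for an
exponent vector `lam ∈ ℕ^N` with `|lam| = |ι|` and `lam + ρ` injective (e.g. `lam` a partition
padded by zeros), `∑_{σ ∈ 𝔖_ι} X^{lam}(σ)² = |ι|!`. [cite: FultonHarrisGTM129, §4.3 (4.16)] -/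
theorem sum_frobeniusChar_mul_self (lam : Fin N → ℕ) (hinj : Function.Injective (lam + rho N))
    (hD : ∑ i, lam i = Fintype.card ι) :
    ∑ σ : Equiv.Perm ι, frobeniusChar N lam σ * frobeniusChar N lam σ =
      (Fintype.card ι).factorial := by
  simp only [frobeniusChar_def]
  rw [sum_coeff_mul_coeff_alternant_mul_fixedWordPoly]
  · rw [Finsupp.coe_equivFunOnFinite_symm, coeff_alternant_X_self hinj, mul_one]
  · simp only [Finsupp.coe_equivFunOnFinite_symm, Pi.add_apply, Finset.sum_add_distrib, hD]

end Extraction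

end Literature.RepresentationTheory.FiniteGroups

end
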